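import Mathlib

/-!
# Crux `TropicalHodgeBound` (stmt-HodgeConjecture-18480), stub 4 — part R1a: values of an alternating
# `4`-form on words, and kernel-checkable comparison of coefficient tables

Route `TropicalWeilObstruction` of `HodgeConjecture`, registered line `birth`
(`Cruxes/TropicalHodgeBound/Lines/birth.lean`), stub `stub_rationalHodgeCoordinates`. The rationality of
tropical cycle classes in period coordinates (Mikhalkin–Zharkov Prop. 4.3, "homology of the torus") is
proved in the sibling files by a discrete Stokes identity for an ARBITRARY alternating `4`-form `Φ` on a
real vector space `V`; the two multilinear identities behind it (prism identity, alternation of the swept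
form; file `…SimplexForms`) are polynomial identities, and this file is the device that lets the kernel
check them:

* a `Φ`-argument is specified slotwise by lists of (atom, integer coefficient) pairs over finitely many
  atoms `x : Fin N → V` (`vecOfList`, `coefOfList`); `apply_specArgs` expands `Φ` multilinearly into
  `Σ_{c : Fin 4 → Fin N} wordCoef S c · Φ(x ∘ c)`;
* `sum_word_eq_altSum` (averaging over `S₄` with `AlternatingMap.map_perm`) and
  `sum_eq_of_altSum_eq_on_sorted` (sorting injective words with `Tuple.sort`): two integer tables give the
  same value as soon as their ALTERNATING SUMS agree on strictly increasing words;
* `altSum_wordCoef` — for a product table the alternating sum is a `4 × 4` integer DETERMINANT (Leibniz),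
  computed by the explicit cofactor formula `det4` (`det4_eq_det`), so that each table check costs a few
  dozen integer operations per sorted word in the kernel (`decide`), with no rational arithmetic and no
  enumeration of permutations.

Pure linear algebra; the definitions are proof devices, not objects of the route. No named fact, no sorry.

References: [MikhalkinZharkov2014Eigenwave] G. Mikhalkin, I. Zharkov, Tropical eigenwave and intermediate
Jacobians, LN UMI 15 (2014), Prop. 4.3; [Zharkov2020TropicalWeil] I. Zharkov, arXiv:2002.02347, p. 2.
-/

set_option linter.dupNamespace false

namespace Summit.HodgeConjecture.HodgeConjecture.Theorems.TropicalHodgeBound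

open scoped BigOperators

section Engine

variable {V : Type*} [AddCommGroup V] [Module ℝ V] {N : ℕ}

/-- Coefficient of the atom `a` in a formal integer combination of atoms given as a list of
(atom, coefficient) pairs. [folklore] -/
def coefOfList (L : List (Fin N × ℤ)) (a : Fin N) : ℤ :=
  (L.map fun p => if p.1 = a then p.2 else 0).sum

/-- The vector described by a list of (atom, coefficient) pairs. [folklore] -/
def vecOfList (L : List (Fin N × ℤ)) (x : Fin N → V) : V :=
  (L.map fun p => (p.2 : ℝ) • x p.1).sum

/-- The empty list has all coefficients `0`. [folklore] -/
@[simp] theorem coefOfList_nil (a : Fin N) : coefOfList ([] : List (Fin N × ℤ)) a = 0 := rfl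

/-- Coefficients of a cons. [folklore] -/
theorem coefOfList_cons (p : Fin N × ℤ) (L : List (Fin N × ℤ)) (a : Fin N) :
    coefOfList (p :: L) a = (if p.1 = a then p.2 else 0) + coefOfList L a := by
  simp [coefOfList]

/-- The empty list describes `0`. [folklore] -/
@[simp] theorem vecOfList_nil (x : Fin N → V) : vecOfList ([] : List (Fin N × ℤ)) x = 0 := rfl

/-- The vector of a cons. [folklore] -/
@[simp] theorem vecOfList_cons (p : Fin N × ℤ) (L : List (Fin N × ℤ)) (x : Fin N → V) :
    vecOfList (p :: L) x = (p.2 : ℝ) • x p.1 + vecOfList L x := by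
  simp [vecOfList]

/-- The list's vector is `Σ_a (coefficient of a) • x a`. [folklore] -/
theorem sum_coefOfList_smul (L : List (Fin N × ℤ)) (x : Fin N → V) :
    ∑ a, (coefOfList L a : ℝ) • x a = vecOfList L x := by
  induction L with
  | nil => simp
  | cons p L ih =>
      rw [vecOfList_cons, ← ih]
      have h : ∀ a, (coefOfList (p :: L) a : ℝ) • x a =
          (if p.1 = a then (p.2 : ℝ) • x a else 0) + (coefOfList L a : ℝ) • x a := by
        intro a
        rw [coefOfList_cons, Int.cast_add, add_smul]
        split_ifs <;> simp
      simp_rw [h]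
      rw [Finset.sum_add_distrib, Finset.sum_ite_eq]
      simp

/-- The coefficient of the word `c` in the expansion of `Φ` on slotwise-specified arguments. [folklore] -/
def wordCoef (S : Fin 4 → List (Fin N × ℤ)) (c : Fin 4 → Fin N) : ℤ :=
  ∏ j, coefOfList (S j) (c j)

/-- **Multilinear expansion over words**: `Φ` applied to the four specified combinations of the atoms
`x` is `Σ_c wordCoef S c · Φ(x ∘ c)`. [folklore] -/
theorem apply_specArgs (Φ : V [⋀^Fin 4]→ₗ[ℝ] ℝ) (S : Fin 4 → List (Fin N × ℤ)) (x : Fin N → V) :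
    Φ (fun j => vecOfList (S j) x) = ∑ c : Fin 4 → Fin N, (wordCoef S c : ℝ) * Φ (x ∘ c) := by
  have h : (fun j => vecOfList (S j) x) = fun j => ∑ a, (coefOfList (S j) a : ℝ) • x a := by
    funext j; rw [sum_coefOfList_smul]
  rw [h]
  change Φ.toMultilinearMap (fun j => ∑ a, (coefOfList (S j) a : ℝ) • x a) = _
  rw [MultilinearMap.map_sum Φ.toMultilinearMap (fun j a => (coefOfList (S j) a : ℝ) • x a)]
  refine Finset.sum_congr rfl fun c _ => ?_
  rw [MultilinearMap.map_smul_univ]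
  change (∏ j, (coefOfList (S j) (c j) : ℝ)) • Φ (fun j => x (c j)) = _
  rw [wordCoef, Int.cast_prod, smul_eq_mul]
  rfl

/-- The alternating sum of a coefficient table over the `24` reorderings of a word. [folklore] -/
def altSum (F : (Fin 4 → Fin N) → ℤ) (c : Fin 4 → Fin N) : ℤ :=
  ∑ π : Equiv.Perm (Fin 4), ((Equiv.Perm.sign π : ℤˣ) : ℤ) * F (c ∘ π)

/-- `altSum` is additive in the table. [folklore] -/
theorem altSum_add (F G : (Fin 4 → Fin N) → ℤ) (c : Fin 4 → Fin N) :
    altSum (fun w => F w + G w) c = altSum F c + altSum G c := by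
  simp [altSum, mul_add, Finset.sum_add_distrib]

/-- `altSum` is homogeneous in the table. [folklore] -/
theorem altSum_const_mul (a : ℤ) (F : (Fin 4 → Fin N) → ℤ) (c : Fin 4 → Fin N) :
    altSum (fun w => a * F w) c = a * altSum F c := by
  simp only [altSum, Finset.mul_sum]
  exact Finset.sum_congr rfl fun π _ => by ring

/-- `altSum` commutes with finite sums of tables. [folklore] -/
theorem altSum_finset_sum {ι : Type*} (s : Finset ι) (F : ι → (Fin 4 → Fin N) → ℤ)
    (c : Fin 4 → Fin N) : altSum (fun w => ∑ i ∈ s, F i w) c = ∑ i ∈ s, altSum (F i) c := by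
  simp only [altSum, Finset.mul_sum]
  rw [Finset.sum_comm]

/-- **Averaging over `S₄`**: `Σ_c F c · Φ(x∘c) = (1/24) Σ_c altSum F c · Φ(x∘c)`. [folklore] -/
theorem sum_word_eq_altSum (Φ : V [⋀^Fin 4]→ₗ[ℝ] ℝ) (F : (Fin 4 → Fin N) → ℤ) (x : Fin N → V) :
    ∑ c : Fin 4 → Fin N, (F c : ℝ) * Φ (x ∘ c) =
      (1 / 24 : ℝ) * ∑ c : Fin 4 → Fin N, (altSum F c : ℝ) * Φ (x ∘ c) := by
  -- for every `π`, reindexing by `c ↦ c ∘ π` and `map_perm`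
  have hπ : ∀ π : Equiv.Perm (Fin 4), ∑ c : Fin 4 → Fin N, (F c : ℝ) * Φ (x ∘ c) =
      ∑ c : Fin 4 → Fin N, (((Equiv.Perm.sign π : ℤˣ) : ℤ) : ℝ) * (F (c ∘ π) : ℝ) * Φ (x ∘ c) := by
    intro π
    have e := Equiv.sum_comp (Equiv.arrowCongr π.symm (Equiv.refl (Fin N)))
      (fun c : Fin 4 → Fin N => (F c : ℝ) * Φ (x ∘ c))
    rw [← e]
    refine Finset.sum_congr rfl fun c _ => ?_
    have hc : (Equiv.arrowCongr π.symm (Equiv.refl (Fin N))) c = c ∘ π := by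
      funext j; simp [Equiv.arrowCongr_apply]
    rw [hc, show x ∘ (c ∘ ⇑π) = (x ∘ c) ∘ ⇑π from rfl, AlternatingMap.map_perm, Units.smul_def,
      zsmul_eq_mul]
    ring
  have hsum : (24 : ℝ) * ∑ c : Fin 4 → Fin N, (F c : ℝ) * Φ (x ∘ c) =
      ∑ c : Fin 4 → Fin N, (altSum F c : ℝ) * Φ (x ∘ c) := by
    have hcard : (Finset.univ : Finset (Equiv.Perm (Fin 4))).card = 24 := by
      rw [Finset.card_univ, Fintype.card_perm, Fintype.card_fin]; rfl
    calc (24 : ℝ) * ∑ c : Fin 4 → Fin N, (F c : ℝ) * Φ (x ∘ c)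
        = ∑ _π : Equiv.Perm (Fin 4), ∑ c : Fin 4 → Fin N, (F c : ℝ) * Φ (x ∘ c) := by
          rw [Finset.sum_const, hcard]; simp
      _ = ∑ π : Equiv.Perm (Fin 4), ∑ c : Fin 4 → Fin N,
            (((Equiv.Perm.sign π : ℤˣ) : ℤ) : ℝ) * (F (c ∘ π) : ℝ) * Φ (x ∘ c) :=
          Finset.sum_congr rfl fun π _ => hπ π
      _ = ∑ c : Fin 4 → Fin N, (altSum F c : ℝ) * Φ (x ∘ c) := by
          rw [Finset.sum_comm]
          refine Finset.sum_congr rfl fun c _ => ?_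
          rw [altSum, Int.cast_sum, Finset.sum_mul]
          refine Finset.sum_congr rfl fun π _ => ?_
          push_cast; ring
  rw [← hsum]; ring

/-- Reordering a word multiplies its alternating sum by the sign. [folklore] -/
theorem altSum_comp_perm (F : (Fin 4 → Fin N) → ℤ) (c : Fin 4 → Fin N) (σ : Equiv.Perm (Fin 4)) :
    altSum F (c ∘ σ) = ((Equiv.Perm.sign σ : ℤˣ) : ℤ) * altSum F c := by
  unfold altSum
  have hs : ((Equiv.Perm.sign σ : ℤˣ) : ℤ) * ((Equiv.Perm.sign σ : ℤˣ) : ℤ) = 1 := by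
    rw [← Units.val_mul, Int.units_mul_self, Units.val_one]
  have hg : ∀ π : Equiv.Perm (Fin 4),
      ((Equiv.Perm.sign π : ℤˣ) : ℤ) * F ((c ∘ ⇑σ) ∘ ⇑π) =
        ((Equiv.Perm.sign σ : ℤˣ) : ℤ) *
          (((Equiv.Perm.sign (σ * π) : ℤˣ) : ℤ) * F (c ∘ ⇑(σ * π))) := by
    intro π
    rw [Equiv.Perm.sign_mul, Units.val_mul, Equiv.Perm.coe_mul]
    calc ((Equiv.Perm.sign π : ℤˣ) : ℤ) * F ((c ∘ ⇑σ) ∘ ⇑π)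
        = (((Equiv.Perm.sign σ : ℤˣ) : ℤ) * ((Equiv.Perm.sign σ : ℤˣ) : ℤ)) *
            ((Equiv.Perm.sign π : ℤˣ) : ℤ) * F (c ∘ (⇑σ ∘ ⇑π)) := by rw [hs, one_mul]; rfl
      _ = _ := by ring
  simp_rw [hg]
  rw [← Finset.mul_sum]
  congr 1
  exact Fintype.sum_equiv (Equiv.mulLeft σ)
    (fun π => ((Equiv.Perm.sign (σ * π) : ℤˣ) : ℤ) * F (c ∘ ⇑(σ * π)))
    (fun π => ((Equiv.Perm.sign π : ℤˣ) : ℤ) * F (c ∘ ⇑π)) (fun π => rfl)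

/-- **Comparison on sorted words**: two coefficient tables whose alternating sums agree on every strictly
increasing word give the same value `Σ_c F c · Φ(x ∘ c)`. [folklore] -/
theorem sum_eq_of_altSum_eq_on_sorted (Φ : V [⋀^Fin 4]→ₗ[ℝ] ℝ) (F G : (Fin 4 → Fin N) → ℤ)
    (x : Fin N → V) (h : ∀ p q r s : Fin N, p < q → q < r → r < s →
      altSum F ![p, q, r, s] = altSum G ![p, q, r, s]) :
    ∑ c : Fin 4 → Fin N, (F c : ℝ) * Φ (x ∘ c) = ∑ c : Fin 4 → Fin N, (G c : ℝ) * Φ (x ∘ c) := by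
  rw [sum_word_eq_altSum Φ F, sum_word_eq_altSum Φ G]
  congr 1
  refine Finset.sum_congr rfl fun c _ => ?_
  by_cases hc : Function.Injective c
  · -- sort the injective word
    let σ := Tuple.sort c
    have hmono : StrictMono (c ∘ σ) := (Tuple.monotone_sort c).strictMono_of_injective
      (hc.comp σ.injective)
    have hw : (![(c ∘ σ) 0, (c ∘ σ) 1, (c ∘ σ) 2, (c ∘ σ) 3] : Fin 4 → Fin N) = c ∘ σ := by
      funext j; fin_cases j <;> rfl
    have h1 := h ((c ∘ σ) 0) ((c ∘ σ) 1) ((c ∘ σ) 2) ((c ∘ σ) 3) (hmono (by decide))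
      (hmono (by decide)) (hmono (by decide))
    rw [hw, altSum_comp_perm, altSum_comp_perm] at h1
    have hne : ((Equiv.Perm.sign σ : ℤˣ) : ℤ) ≠ 0 := by
      rcases Int.units_eq_one_or (Equiv.Perm.sign σ) with h' | h' <;> simp [h']
    rw [mul_right_inj' hne] at h1
    rw [h1]
  · rw [AlternatingMap.map_eq_zero_of_not_injective Φ (x ∘ c) fun hi => hc hi.of_comp, mul_zero,
      mul_zero]

/-! ### Alternating sums of product tables are determinants -/

/-- Explicit `3 × 3` integer determinant (rule of Sarrus). [folklore] -/
def det3 (m : Fin 3 → Fin 3 → ℤ) : ℤ :=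
  m 0 0 * m 1 1 * m 2 2 - m 0 0 * m 1 2 * m 2 1 - m 0 1 * m 1 0 * m 2 2 + m 0 1 * m 1 2 * m 2 0 +
    m 0 2 * m 1 0 * m 2 1 - m 0 2 * m 1 1 * m 2 0

/-- Explicit `4 × 4` integer determinant (Laplace expansion along the first row). [folklore] -/
def det4 (M : Fin 4 → Fin 4 → ℤ) : ℤ :=
  M 0 0 * det3 (fun a b => M a.succ ((0 : Fin 4).succAbove b)) -
    M 0 1 * det3 (fun a b => M a.succ ((1 : Fin 4).succAbove b)) +
    M 0 2 * det3 (fun a b => M a.succ ((2 : Fin 4).succAbove b)) -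
    M 0 3 * det3 (fun a b => M a.succ ((3 : Fin 4).succAbove b))

/-- `det4` is the determinant. [folklore] -/
theorem det4_eq_det (M : Fin 4 → Fin 4 → ℤ) : det4 M = (Matrix.of M).det := by
  rw [Matrix.det_succ_row_zero, Fin.sum_univ_four]
  simp only [Matrix.det_fin_three, Matrix.submatrix_apply, Matrix.of_apply, det4, det3]
  norm_num
  ring

/-- The `4 × 4` determinant attached to a slotwise spec `S` and a word `w`: entries
`coefOfList (S j) (w k)`. [folklore] -/
def tabDet (S : Fin 4 → List (Fin N × ℤ)) (w : Fin 4 → Fin N) : ℤ :=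
  det4 (fun j k => coefOfList (S j) (w k))

/-- **Leibniz**: the alternating sum of a product table at a word is the determinant `tabDet`.
[folklore] -/
theorem altSum_wordCoef (S : Fin 4 → List (Fin N × ℤ)) (w : Fin 4 → Fin N) :
    altSum (wordCoef S) w = tabDet S w := by
  rw [tabDet, det4_eq_det, ← Matrix.det_transpose, Matrix.det_apply']
  unfold altSum wordCoef
  refine Finset.sum_congr rfl fun π _ => ?_
  simp only [Int.cast_id, Matrix.transpose_apply, Matrix.of_apply, Function.comp_apply]

/-- The eight subsets of `Fin 3`, as a list (kernel-friendly indexing of the swept form's terms).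
[folklore] -/
def subsets3 : List (Finset (Fin 3)) := [∅, {0}, {1}, {2}, {0, 1}, {0, 2}, {1, 2}, {0, 1, 2}]

/-- Summing over `Finset (Fin 3)` is summing over the list `subsets3`. [folklore] -/
theorem sum_subsets3 (g : Finset (Fin 3) → ℤ) : ∑ A : Finset (Fin 3), g A = (subsets3.map g).sum := by
  have hn : subsets3.Nodup := by decide
  have hu : (Finset.univ : Finset (Finset (Fin 3))) = subsets3.toFinset := by decide
  rw [hu, List.sum_toFinset g hn]

/-- Summing over `Fin 5` is summing over `List.finRange 5`. [folklore] -/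
theorem sum_fin5 (g : Fin 5 → ℤ) : ∑ i : Fin 5, g i = ((List.finRange 5).map g).sum :=
  Fin.sum_univ_def g

end Engine

end Summit.HodgeConjecture.HodgeConjecture.Theorems.TropicalHodgeBound
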